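import Mathlib
import Summits.Ventures.PercRepro2.ZMeanProof
import Summits.Ventures.PercRepro2.PendantEdm

/-!
# Parallel edges collapse to one coin: the mean field and (HMF) under merging two parallel edges
(blind cell PercRepro2, night-1 g9; NIGHT1-G9.md §5)

Let `e₁ ≠ e₂` have the same endpoints.  Every event of `HMFc` is a function of the open graph (for
the residual events, of the open graph of the restriction), and with `e₂` open the state of `e₁`
does not change the open graph (`openGraph_update_of_parallel`): such events are *parallel-invariant*
(`ParInv`).  Pinning `e₂`, then `e₁`, the probability of a parallel-invariant event under `p` equals
its probability under `p[e₁ ↦ 1 − (1 − p e₁)(1 − p e₂)][e₂ ↦ 0]` (`prob_merge`) — the merged coin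
on `e₁`, the edge `e₂` of weight `0` (and then invisible, ZeroEdges).  Hence **`HMFc_merge`** and
`HMF_merge_iff`: any number of parallel edges collapses to one coin in every class theorem.
-/

namespace Summit.Ventures.PercRepro2

open UnionCluster CovForm

namespace ParallelMerge

section Graph

variable {V : Type*} {E : Type*} [DecidableEq E]

/-- The open graph does not see the state of `e₁` when its parallel edge `e₂` is open. -/
lemma openGraph_update_of_parallel {ends : E → Sym2 V} {e₁ e₂ : E} (hne : e₁ ≠ e₂)
    (hpar : ends e₁ = ends e₂) {ω : Config E} (h2 : ω e₂ = true) (b : Bool) :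
    openGraph ends (Function.update ω e₁ b) = openGraph ends ω := by
  ext u v
  rw [openGraph_adj, openGraph_adj]
  refine and_congr_right fun _ => ?_
  constructor
  · rintro ⟨e, he, hends⟩
    by_cases hee : e = e₁
    · subst hee
      exact ⟨e₂, h2, hpar ▸ hends⟩
    · rw [Function.update_of_ne hee] at he
      exact ⟨e, he, hends⟩
  · rintro ⟨e, he, hends⟩
    by_cases hee : e = e₁
    · subst hee
      exact ⟨e₂, by rw [Function.update_of_ne (Ne.symm hne)]; exact h2, hpar ▸ hends⟩
    · exact ⟨e, by rw [Function.update_of_ne hee]; exact he, hends⟩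

/-- Connections do not see the state of `e₁` when `e₂` is open. -/
lemma conn_update_of_parallel {ends : E → Sym2 V} {e₁ e₂ : E} (hne : e₁ ≠ e₂)
    (hpar : ends e₁ = ends e₂) {ω : Config E} (h2 : ω e₂ = true) (b : Bool) (u v : V) :
    Conn ends (Function.update ω e₁ b) u v ↔ Conn ends ω u v := by
  unfold Conn
  rw [openGraph_update_of_parallel hne hpar h2]

/-- Clusters do not see the state of `e₁` when `e₂` is open. -/
lemma cluster_update_of_parallel {ends : E → Sym2 V} {e₁ e₂ : E} (hne : e₁ ≠ e₂)
    (hpar : ends e₁ = ends e₂) {ω : Config E} (h2 : ω e₂ = true) (b : Bool) (v : V) :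
    cluster ends (Function.update ω e₁ b) v = cluster ends ω v := by
  ext u
  simp only [mem_cluster, conn_update_of_parallel hne hpar h2]

/-- `restrict F` of an update. -/
lemma restrict_update (F : Set E) [DecidablePred (· ∈ F)] (ω : Config E) (e : E) (b : Bool) :
    restrict F (Function.update ω e b) = Function.update (restrict F ω) e (b && decide (e ∈ F)) := by
  funext e'
  by_cases hee : e' = e
  · subst hee
    simp [restrict]
  · simp [restrict, Function.update_of_ne hee]

/-- Residual connections do not see the state of `e₁` when `e₂` is open (the two parallel edges
touch the same vertex sets). -/
lemma connDel_update_of_parallel [Fintype V] [DecidableEq V] {ends : E → Sym2 V} {e₁ e₂ : E}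
    (hne : e₁ ≠ e₂) (hpar : ends e₁ = ends e₂) {ω : Config E} (h2 : ω e₂ = true) (b : Bool)
    (W : Finset V) (u v : V) :
    Conn ends (restrict (touches ends (↑W : Set V))ᶜ (Function.update ω e₁ b)) u v ↔
      Conn ends (restrict (touches ends (↑W : Set V))ᶜ ω) u v := by
  rw [restrict_update]
  have hmem : e₁ ∈ (touches ends (↑W : Set V))ᶜ ↔ e₂ ∈ (touches ends (↑W : Set V))ᶜ := by
    simp only [Set.mem_compl_iff, touches, Set.mem_setOf_eq, hpar]
  by_cases h1 : e₁ ∈ (touches ends (↑W : Set V))ᶜ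
  · have h2' : restrict (touches ends (↑W : Set V))ᶜ ω e₂ = true := by
      rw [restrict_apply_of_mem (hmem.1 h1)]; exact h2
    exact conn_update_of_parallel hne hpar h2' _ u v
  · have e0 : (restrict (touches ends (↑W : Set V))ᶜ ω) e₁ = false := restrict_apply_of_notMem h1
    simp only [h1, decide_false, Bool.and_false]
    rw [← e0, Function.update_eq_self]

end Graph

section Inv

variable {V : Type*} {E : Type*} [DecidableEq E]

/-- A parallel-invariant event: with `e₂` open, the state of `e₁` is irrelevant. -/
def ParInv (e₁ e₂ : E) (A : Set (Config E)) : Prop :=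
  ∀ (ω : Config E) (b : Bool), ω e₂ = true → (Function.update ω e₁ b ∈ A ↔ ω ∈ A)

variable {e₁ e₂ : E}

/-- Intersections of parallel-invariant events. -/
lemma ParInv.inter {A B : Set (Config E)} (hA : ParInv e₁ e₂ A) (hB : ParInv e₁ e₂ B) :
    ParInv e₁ e₂ (A ∩ B) := fun ω b h => by
  simp only [Set.mem_inter_iff, hA ω b h, hB ω b h]

/-- Complements of parallel-invariant events. -/
lemma ParInv.compl {A : Set (Config E)} (hA : ParInv e₁ e₂ A) : ParInv e₁ e₂ Aᶜ := fun ω b h => by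
  simp only [Set.mem_compl_iff, hA ω b h]

/-- Unions of parallel-invariant events. -/
lemma ParInv.union {A B : Set (Config E)} (hA : ParInv e₁ e₂ A) (hB : ParInv e₁ e₂ B) :
    ParInv e₁ e₂ (A ∪ B) := fun ω b h => by
  simp only [Set.mem_union, hA ω b h, hB ω b h]

variable {ends : E → Sym2 V} (hne : e₁ ≠ e₂) (hpar : ends e₁ = ends e₂)
include hne hpar

/-- Connection events are parallel-invariant. -/
lemma parInv_connEvent (u v : V) : ParInv e₁ e₂ (connEvent ends u v) := fun ω b h => by
  simp only [mem_connEvent, conn_update_of_parallel hne hpar h]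

/-- Avoidance events are parallel-invariant. -/
lemma parInv_avoidAll (s : V) (X : Finset V) : ParInv e₁ e₂ (avoidAll ends s X) := fun ω b h => by
  simp only [avoidAll, Set.mem_setOf_eq, conn_update_of_parallel hne hpar h]

/-- Cluster events are parallel-invariant. -/
lemma parInv_clusterEvent (v : V) (S : Set V) : ParInv e₁ e₂ (clusterEvent ends v S) :=
  fun ω b h => by simp only [mem_clusterEvent, cluster_update_of_parallel hne hpar h]

/-- `PD` is parallel-invariant. -/
lemma parInv_PDEvent (a₁ a₂ a₃ : V) : ParInv e₁ e₂ (PDEvent ends a₁ a₂ a₃) := by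
  unfold PDEvent Dtilde UnionCluster.inU
  exact (parInv_connEvent hne hpar _ _).compl.inter
    ((parInv_connEvent hne hpar _ _).union (parInv_connEvent hne hpar _ _)).compl

/-- `T` is parallel-invariant. -/
lemma parInv_TEvent (a₁ a₂ a₃ : V) : ParInv e₁ e₂ (TEvent ends a₁ a₂ a₃) := by
  unfold TEvent
  exact (parInv_connEvent hne hpar _ _).compl.inter (parInv_connEvent hne hpar _ _)

/-- Residual connection events are parallel-invariant. -/
lemma parInv_connDelEvent [Fintype V] [DecidableEq V] (W : Finset V) (u w : V) :
    ParInv e₁ e₂ (connDelEvent ends W u w) := fun ω b h => by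
  simp only [connDelEvent, Set.mem_setOf_eq, connDel_update_of_parallel hne hpar h]

/-- The residual `Q` is parallel-invariant. -/
lemma parInv_delQ [Fintype V] [DecidableEq V] (W : Finset V) (a₁ a₂ : V) :
    ParInv e₁ e₂ (delQ ends W a₁ a₂) := (parInv_connDelEvent hne hpar W a₁ a₂).compl

end Inv

section Prob

variable {V : Type*} {E : Type*} [Fintype E] [DecidableEq E] {R : Type*} [Field R]
  [LinearOrder R] [IsStrictOrderedRing R]

variable (p : E → R) {e₁ e₂ : E} (hne : e₁ ≠ e₂)
include hne

omit [Fintype E] [LinearOrder R] [IsStrictOrderedRing R] in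
/-- A parallel-invariant event intersected with `{e₂ open}` is free of `e₁`. -/
lemma free_of_parInv {A : Set (Config E)} (hA : ParInv e₁ e₂ A) :
    PendantRoot.Free e₁ (A ∩ openEdge e₂) := by
  intro ω ω' h
  have h2 : ω e₂ = ω' e₂ := h e₂ (by simpa using hne.symm)
  have hω' : ω' = Function.update ω e₁ (ω' e₁) := by
    funext e
    by_cases hee : e = e₁
    · subst hee; simp
    · rw [Function.update_of_ne hee]; exact (h e hee).symm
  show (ω ∈ A ∩ openEdge e₂) = (ω' ∈ A ∩ openEdge e₂)
  apply propext
  simp only [Set.mem_inter_iff, mem_openEdge, h2]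
  constructor
  · rintro ⟨hAω, h2'⟩
    refine ⟨?_, h2'⟩
    rw [hω']
    exact (hA ω _ (h2 ▸ h2')).2 hAω
  · rintro ⟨hAω', h2'⟩
    refine ⟨?_, h2'⟩
    rw [hω'] at hAω'
    exact (hA ω _ (h2 ▸ h2')).1 hAω'

omit [LinearOrder R] [IsStrictOrderedRing R] in
/-- With `e₂` sure, pinning `e₁` does not change the probability of a parallel-invariant event. -/
lemma prob_update_one_update_of_parInv {A : Set (Config E)} (hA : ParInv e₁ e₂ A) (c : R) :
    prob (Function.update (Function.update p e₂ 1) e₁ c) A = prob (Function.update p e₂ 1) A := by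
  have h1 := prob_update_one_inter_openEdge (Function.update (Function.update p e₂ 1) e₁ c) A e₂
  rw [Function.update_comm hne, Function.update_idem] at h1
  rw [← h1, PendantEdm.prob_update_of_free (Function.update p e₂ 1) (free_of_parInv hne hA) c,
    prob_update_one_inter_openEdge]

omit [LinearOrder R] [IsStrictOrderedRing R] in
/-- **The merge identity**: for an event invariant under each parallel edge given the other,
`P_p(A) = P_{p[e₁ ↦ 1 − (1 − p e₁)(1 − p e₂)][e₂ ↦ 0]}(A)`. -/
theorem prob_merge {A : Set (Config E)} (hA : ParInv e₁ e₂ A) (hA' : ParInv e₂ e₁ A) :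
    prob p A =
      prob (Function.update (Function.update p e₁ (1 - (1 - p e₁) * (1 - p e₂))) e₂ 0) A := by
  -- pin `e₂` in `p`, then `e₁` in the closed branch
  have s1 := prob_eq_pin p A e₂
  have s2 := prob_eq_pin (Function.update p e₂ 0) A e₁
  -- the open branch: with `e₂` sure `e₁` is irrelevant; with `e₁` sure `e₂` is irrelevant
  have s3 : prob (Function.update p e₂ 1) A =
      prob (Function.update (Function.update p e₂ 0) e₁ 1) A := by
    rw [← prob_update_one_update_of_parInv p hne hA 1, Function.update_comm hne.symm,
      prob_update_one_update_of_parInv p hne.symm hA' 1,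
      ← prob_update_one_update_of_parInv p hne.symm hA' 0, Function.update_comm hne]
  -- pin `e₁` in the merged weights
  have s4 := prob_eq_pin (Function.update (Function.update p e₁ (1 - (1 - p e₁) * (1 - p e₂))) e₂ 0)
    A e₁
  have hq : Function.update (Function.update p e₁ (1 - (1 - p e₁) * (1 - p e₂))) e₂ 0 e₁ =
      1 - (1 - p e₁) * (1 - p e₂) := by
    rw [Function.update_of_ne hne, Function.update_self]
  have hu1 : Function.update (Function.update (Function.update p e₁ (1 - (1 - p e₁) * (1 - p e₂)))
      e₂ 0) e₁ 1 = Function.update (Function.update p e₂ 0) e₁ 1 := by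
    rw [Function.update_comm (Ne.symm hne), Function.update_idem, Function.update_comm hne]
  have hu0 : Function.update (Function.update (Function.update p e₁ (1 - (1 - p e₁) * (1 - p e₂)))
      e₂ 0) e₁ 0 = Function.update (Function.update p e₂ 0) e₁ 0 := by
    rw [Function.update_comm (Ne.symm hne), Function.update_idem, Function.update_comm hne]
  rw [hq, hu1, hu0] at s4
  have h0 : Function.update p e₂ 0 e₁ = p e₁ := Function.update_of_ne hne _ _
  rw [h0] at s2
  rw [s4, s1, s2, s3]
  ring

end Prob

section HMF

variable {V : Type*} {E : Type*} [Fintype E] [DecidableEq E] [Fintype V] [DecidableEq V]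
  {R : Type*} [Field R] [LinearOrder R] [IsStrictOrderedRing R]

variable (p : E → R) (ends : E → Sym2 V) {e₁ e₂ : E} (hne : e₁ ≠ e₂) (hpar : ends e₁ = ends e₂)
include hne hpar

omit [Fintype V] [DecidableEq V] [LinearOrder R] [IsStrictOrderedRing R] in
/-- The merge identity for an event built from connection events. -/
lemma prob_merge_of (A : Set (Config E))
    (hA : ∀ {e₁ e₂ : E}, e₁ ≠ e₂ → ends e₁ = ends e₂ → ParInv e₁ e₂ A) :
    prob p A = prob (Function.update (Function.update p e₁ (1 - (1 - p e₁) * (1 - p e₂))) e₂ 0) A :=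
  prob_merge p hne (hA hne hpar) (hA hne.symm hpar.symm)

omit [LinearOrder R] [IsStrictOrderedRing R] in
/-- Residual connection probabilities merge. -/
lemma delConnProb_merge (W : Finset V) (x v : V) :
    delConnProb p ends W x v =
      delConnProb (Function.update (Function.update p e₁ (1 - (1 - p e₁) * (1 - p e₂))) e₂ 0) ends
        W x v := by
  unfold delConnProb
  rw [prob_merge_of p ends hne hpar _ (fun h h' => parInv_connDelEvent h h' W x v)]

omit [LinearOrder R] [IsStrictOrderedRing R] in
/-- Residual shares merge. -/
lemma delShareMass_merge (W : Finset V) (a₁ a₂ x v : V) :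
    delShareMass p ends W a₁ a₂ x v =
      delShareMass (Function.update (Function.update p e₁ (1 - (1 - p e₁) * (1 - p e₂))) e₂ 0) ends
        W a₁ a₂ x v := by
  unfold delShareMass
  rw [prob_merge_of p ends hne hpar _
    (fun h h' => (parInv_delQ h h' W a₁ a₂).inter (parInv_connDelEvent h h' W x v))]

omit [LinearOrder R] [IsStrictOrderedRing R] in
/-- The rows of `X̂` merge. -/
lemma termW_merge (o a₁ a₂ b : V) (W : Finset V) :
    termW p ends o a₁ a₂ b W =
      termW (Function.update (Function.update p e₁ (1 - (1 - p e₁) * (1 - p e₂))) e₂ 0) ends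
        o a₁ a₂ b W := by
  unfold termW termT termPD
  simp only [delConnProb_merge p ends hne hpar, delShareMass_merge p ends hne hpar,
    prob_merge_of p ends hne hpar (delQ ends W a₁ a₂) (fun h h' => parInv_delQ h h' W a₁ a₂)]

omit [LinearOrder R] [IsStrictOrderedRing R] in
/-- The mean field `X̂` merges. -/
lemma Xhat_merge (o a₁ a₂ a₃ b : V) :
    Xhat p ends o a₁ a₂ a₃ b =
      Xhat (Function.update (Function.update p e₁ (1 - (1 - p e₁) * (1 - p e₂))) e₂ 0) ends
        o a₁ a₂ a₃ b := by
  rw [Xhat_eq_sum, Xhat_eq_sum]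
  refine Finset.sum_congr rfl fun W _ => ?_
  rw [prob_merge_of p ends hne hpar _ (fun h h' => parInv_clusterEvent h h' a₃ _),
    termW_merge p ends hne hpar]

omit [LinearOrder R] [IsStrictOrderedRing R] in
/-- **The cleared mean field is invariant under merging two parallel edges.** -/
theorem HMFc_merge (o a₁ a₂ a₃ b : V) :
    HMFc p ends o a₁ a₂ a₃ b =
      HMFc (Function.update (Function.update p e₁ (1 - (1 - p e₁) * (1 - p e₂))) e₂ 0) ends
        o a₁ a₂ a₃ b := by
  have hQ : ∀ x y, prob p (avoidAll ends a₂ {a₁} ∩ connEvent ends x y) =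
      prob (Function.update (Function.update p e₁ (1 - (1 - p e₁) * (1 - p e₂))) e₂ 0)
        (avoidAll ends a₂ {a₁} ∩ connEvent ends x y) := fun x y =>
    prob_merge_of p ends hne hpar _
      (fun h h' => (parInv_avoidAll h h' a₂ {a₁}).inter (parInv_connEvent h h' x y))
  have hQ0 : prob p (avoidAll ends a₂ {a₁}) =
      prob (Function.update (Function.update p e₁ (1 - (1 - p e₁) * (1 - p e₂))) e₂ 0)
        (avoidAll ends a₂ {a₁}) :=
    prob_merge_of p ends hne hpar _ (fun h h' => parInv_avoidAll h h' a₂ {a₁})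
  have hPD : ∀ x y, prob p (PDEvent ends a₁ a₂ a₃ ∩ connEvent ends x y) =
      prob (Function.update (Function.update p e₁ (1 - (1 - p e₁) * (1 - p e₂))) e₂ 0)
        (PDEvent ends a₁ a₂ a₃ ∩ connEvent ends x y) := fun x y =>
    prob_merge_of p ends hne hpar _
      (fun h h' => (parInv_PDEvent h h' a₁ a₂ a₃).inter (parInv_connEvent h h' x y))
  have hPD0 : prob p (PDEvent ends a₁ a₂ a₃) =
      prob (Function.update (Function.update p e₁ (1 - (1 - p e₁) * (1 - p e₂))) e₂ 0)
        (PDEvent ends a₁ a₂ a₃) :=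
    prob_merge_of p ends hne hpar _ (fun h h' => parInv_PDEvent h h' a₁ a₂ a₃)
  have hT : ∀ x y z x' y', prob p (TEvent ends x y z ∩ connEvent ends x' y') =
      prob (Function.update (Function.update p e₁ (1 - (1 - p e₁) * (1 - p e₂))) e₂ 0)
        (TEvent ends x y z ∩ connEvent ends x' y') := fun x y z x' y' =>
    prob_merge_of p ends hne hpar _
      (fun h h' => (parInv_TEvent h h' x y z).inter (parInv_connEvent h h' x' y'))
  have hT' : ∀ x y z x' y', prob p (connEvent ends x' y' ∩ TEvent ends x y z) =
      prob (Function.update (Function.update p e₁ (1 - (1 - p e₁) * (1 - p e₂))) e₂ 0)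
        (connEvent ends x' y' ∩ TEvent ends x y z) := fun x y z x' y' =>
    prob_merge_of p ends hne hpar _
      (fun h h' => (parInv_connEvent h h' x' y').inter (parInv_TEvent h h' x y z))
  have hT0 : ∀ x y z, prob p (TEvent ends x y z) =
      prob (Function.update (Function.update p e₁ (1 - (1 - p e₁) * (1 - p e₂))) e₂ 0)
        (TEvent ends x y z) := fun x y z =>
    prob_merge_of p ends hne hpar _ (fun h h' => parInv_TEvent h h' x y z)
  have hc : ∀ x y, prob p (connEvent ends x y) =
      prob (Function.update (Function.update p e₁ (1 - (1 - p e₁) * (1 - p e₂))) e₂ 0)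
        (connEvent ends x y) := fun x y =>
    prob_merge_of p ends hne hpar _ (fun h h' => parInv_connEvent h h' x y)
  unfold HMFc CovForm.marginC CovForm.DEF CovForm.EQo CovForm.EQ3 CovForm.EQ3o CovForm.Do massM2
    deltaT CovForm.gap
  simp only [hQ, hQ0, hPD, hPD0, hT, hT', hT0, hc, Xhat_merge p ends hne hpar]

omit [IsStrictOrderedRing R] in
/-- **(HMF) is invariant under merging two parallel edges**: the merged coin
`1 − (1 − p e₁)(1 − p e₂)` on `e₁`, weight `0` on `e₂`. -/
theorem HMF_merge_iff (o a₁ a₂ a₃ b : V) :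
    HMF p ends o a₁ a₂ a₃ b ↔
      HMF (Function.update (Function.update p e₁ (1 - (1 - p e₁) * (1 - p e₂))) e₂ 0) ends
        o a₁ a₂ a₃ b := by
  unfold HMF
  rw [HMFc_merge p ends hne hpar]

omit [Fintype E] [Fintype V] [DecidableEq V] in
/-- The merged weights form a probability vector. -/
lemma isProbVec_merge (hp : IsProbVec p) :
    IsProbVec (Function.update (Function.update p e₁ (1 - (1 - p e₁) * (1 - p e₂))) e₂ 0) := by
  have h1 := hp.nonneg e₁; have h2 := hp.nonneg e₂; have h3 := hp.le_one e₁; have h4 := hp.le_one e₂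
  refine ⟨fun e => ?_, fun e => ?_⟩
  · by_cases he2 : e = e₂
    · subst he2; simp
    · rw [Function.update_of_ne he2]
      by_cases he1 : e = e₁
      · subst he1; rw [Function.update_self]; nlinarith
      · rw [Function.update_of_ne he1]; exact hp.nonneg e
  · by_cases he2 : e = e₂
    · subst he2; simp
    · rw [Function.update_of_ne he2]
      by_cases he1 : e = e₁
      · subst he1; rw [Function.update_self]; nlinarith
      · rw [Function.update_of_ne he1]; exact hp.le_one e

end HMF

end ParallelMerge

end Summit.Ventures.PercRepro2
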